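import Literature.AnabelianGeometry.EtaleTheta.Discharge.Sec4Thm44
import Literature.AnabelianGeometry.EtaleTheta.Discharge.Sec4Prop43iiHolds

/-!
# [EtTh] Prop 4.3 (iii): the bi-Kummer difference is a twisted homomorphism; its class is invariant

S. Mochizuki, *The étale theta function and its Frobenioid-theoretic manifestations*, Publ. RIMS **45**
(2009) [MochizukiEtTh2009], §4, Proposition 4.3 (iii), printed p.317 (PDF p.91), verbatim: "(iii) In the
notation of (i), the difference `s'_N{}^{gp} · (s''_N{}^{gp})⁻¹` determines a twisted homomorphism
`H_{B_N} → μ_N(B_N)`, hence an element of the cohomology module `H¹(H_{B_N}, μ_N(B_N))`, which is equal to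
the Kummer class [cf. [Mzk18], Definition 2.1, (ii)] `κ_{f|_{B_N}} ∈ H¹(H_{B_N}, μ_N(B_N))` of `f|_{B_N}`
[cf. the notation of Proposition 4.2, (iii)].  In particular, this cohomology class is independent of the
[simultaneous and non-simultaneous] conjugation operations discussed in (ii)."  Printed proof (p.317):
"Assertion (iii) follows immediately from the definitions".
[cite: MochizukiEtTh2009, Prop 4.3 (iii) p.317 (PDF p.91)]

abc-iut cell, layer L2, cone node `EtTh:Prop4.3(iii)`; W6 tranche-2 row d077 (seat abc-iut-w6-d077).
PROOF-ONLY companion (no `def`, no `instance`, no named fact) of abc-iut-L2-t3's statement file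
`BiKummerRoots.lean` (`BiKummerSetting.BiKummerRoot`, `Prop43_iii`, `Prop43_ii`) and of
`Discharge/Sec4Thm44.lean` (the small `O^×`/`μ_N` API and `BiKummerRoot.autBase_sNum/_sDen`: the two
bi-Kummer sections LIE OVER `H_{B_N}`).

Clause census of Prop 4.3 (iii) versus the tree (this file adds the clauses marked NEW):
* (C1a) VALUES: `s'{}^{gp}(h) · s''{}^{gp}(h)⁻¹ ∈ μ_N(B_N)` — `BiKummerRoot.sNum_mul_sDen_inv_mem_mu` /
  `prop43_iii_of` (`Discharge/Sec4BiKummerRoots.lean`, modulo the [FrdI] dictionary inputs),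
  `prop43_iii_mkOfModel` (`Discharge/Sec4Model.lean`), and for the assembled §5 data
  `biKummerDifferenceMem_ofBiKummerData` (`Discharge/Sec5OfBiKummerDataKummer.lean`);
* (C1b) NEW — "determines a TWISTED HOMOMORPHISM": the crossed-homomorphism identity
  `c(hk) = c(h) · (ʰc(k))`, where `c(h) := s'{}^{gp}(h) · s''{}^{gp}(h)⁻¹` and `H_{B_N}` acts on the
  commutative normal subgroup `O^×(B_N) ⊆ Aut_C(B_N)` (hence on `μ_N(B_N)`) by conjugation — either through
  the section `s'{}^{gp}` (`BiKummerRoot.diff_mul`) or through `H_{B_N} ⊆ Aut_C(B_N)` itself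
  (`BiKummerRoot.diff_mul_conj`); the two conjugations agree on `O^×(B_N)` because `s'{}^{gp}(h) · h⁻¹ ∈
  O^×(B_N)` (`sNum_mul_inv_mem_units`, from `autBase_sNum`) and `O^×(B_N)` is commutative and normal
  (`units_comm` of `Sec4Thm44.lean` ← [FrdI] Thm 5.2 (i) `ModelFrobenioid.isMulCommutative_units`;
  `conj_mem_units` here).  This is UNCONDITIONAL for every `BiKummerSetting` and every bi-Kummer root.
* (C2) "hence an element of `H¹(H_{B_N}, μ_N(B_N))`" — rendered WITHOUT introducing a definition: (C1b) is
  literally the cocycle identity `f(gh) = f(g) · (φ(g) f(h) φ(g)⁻¹)` of the tree's `contCocycles φ A H`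
  (`EtaleTheta/ContH1.lean`, crossed homomorphisms into a commutative normal subgroup for the conjugation
  action through `φ`), and "the same class" below is the tree's `contCoboundaries` relation
  `f' = f · (h ↦ (ʰa) · a⁻¹)` with `a ∈ μ_N(B_N)` (`BiKummerRoot.conj_mul_inv_mem_mu`: such coboundaries are
  `μ_N(B_N)`-valued).  No `H¹`-valued constant is declared here (DEFS-FREEZE, L2).
* (C3) "equal to the Kummer class `κ_{f|_{B_N}}`" — NOT in this file: abc-iut-L2-t3's row (R175) at the
  model instances, over its `BiKummerSetting.kummerClassOfRoot` (`BiKummerKummerClass.lean`).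
* (C4) NEW — "independent of the [simultaneous and non-simultaneous] conjugation operations discussed in
  (ii)": (a) simultaneous conjugation by `ζ ∈ O^×(B_N)` leaves `c` UNCHANGED on the nose
  (`BiKummerRoot.diff_eq_of_conj`); (a)+(b) with the non-simultaneous `u ∈ μ_N(B_N)` multiplies `c` by the
  coboundary `h ↦ (ʰu) · u⁻¹` (`BiKummerRoot.diff_eq_mul_coboundary_of_conj`, through `s'{}^{gp}` or through
  `h`); and, composed with the THEOREM `prop43_ii_holds` (`Discharge/Sec4Prop43iiHolds.lean`: Prop 4.3 (ii)
  as typed holds for every setting), the UNCONDITIONAL corollary `BiKummerRoot.exists_mu_diff_eq_mul_coboundary`: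
  any two bi-Kummer roots on the same `N`-th root with the same identification `H_{A_N} ≅ H_{B_N}` and
  `O^×(A_N)`-conjugate trivializing sections (domain `≅ A_⊙`) have cohomologous difference cocycles.

HONEST FRAMING: refereed pre-IUT material ([EtTh] 2009, [FrdI]/[FrdII] 2008); elementary group theory over
the typed §4 setting; nothing here bears on [IUTchIII] Cor. 3.12 and no side is taken; typed ≠ proved.
-/

noncomputable section

namespace Literature.AnabelianGeometry.EtaleTheta

open CategoryTheory Opposite Literature.AlgebraicGeometry.Frobenioids

namespace BiKummerSetting

universe u₀ v₀ u v w

variable {K : Type u₀} [Field K]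
variable {X : SemiGraphs.TemperedArithmeticGroup.{u₀} K} {D₀ : Type u₀} [Category.{v₀} D₀] {V : FrdIMonoidStub.{w}}
  {T : RealifiedDivisorMonoids (D₀ := D₀) V} {D : Type u} [Category.{v} D]
  {VD : FrdICatStub.{u, v, w} D} (S : BiKummerSetting X T D VD)

/-! ### `O^×(A)` is normal in `Aut_C(A)`; `μ_N(A)` is stable under conjugation -/

/-- `O^×(A)` is a NORMAL subgroup of `Aut_C(A)`: `g ζ g⁻¹` is again base-identity (`Base` is a homomorphism
on `Aut_C(A)`) and linear (every automorphism of the model Frobenioid has Frobenius degree `1`).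
[cite: MochizukiFrdI2008, Def. 1.2(ii)] -/
theorem conj_mem_units {A : S.C} (g : Aut A) {x : Aut A} (hx : x ∈ S.units A) :
    g * x * g⁻¹ ∈ S.units A := by
  refine ⟨?_, ?_⟩
  · have h1 : S.autBase A (g * x * g⁻¹) = 1 := by
      rw [map_mul, map_mul, map_inv, S.autBase_eq_one_of_mem_units hx, mul_one, mul_inv_cancel]
    exact congrArg Iso.hom h1
  · exact (ModelFrobenioid.degFr_hom_eq_one _).1

/-- `μ_N(A)` is stable under conjugation by `Aut_C(A)`. [cite: MochizukiEtTh2009, Def 4.1 p.87] -/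
theorem conj_mem_mu {A : S.C} {N : ℕ+} (g : Aut A) {u : Aut A} (hu : u ∈ S.mu A N) :
    g * u * g⁻¹ ∈ S.mu A N :=
  ⟨S.conj_mem_units g hu.1, by rw [conj_pow, hu.2, mul_one, mul_inv_cancel]⟩

/-- The conjugation action of `Aut_C(A)` on the commutative normal subgroup `O^×(A)` factors through
`Aut_C(A)/O^×(A)`: if `g' g⁻¹ ∈ O^×(A)` then `g' ζ g'⁻¹ = g ζ g⁻¹` for `ζ ∈ O^×(A)`.
[cite: MochizukiFrdI2008, Def. 1.2(ii)] -/
theorem conj_eq_conj_of_mul_inv_mem_units {A : S.C} {g g' : Aut A} (hg : g' * g⁻¹ ∈ S.units A)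
    {x : Aut A} (hx : x ∈ S.units A) : g' * x * g'⁻¹ = g * x * g⁻¹ := by
  have hc : g' * g⁻¹ * (g * x * g⁻¹) = g * x * g⁻¹ * (g' * g⁻¹) :=
    S.units_comm hg (S.conj_mem_units g hx)
  calc g' * x * g'⁻¹ = (g' * g⁻¹) * (g * x * g⁻¹) * (g' * g⁻¹)⁻¹ := by group
    _ = g * x * g⁻¹ * (g' * g⁻¹) * (g' * g⁻¹)⁻¹ := by rw [hc]
    _ = g * x * g⁻¹ := by group

/-- A coboundary `(g u g⁻¹) · u⁻¹` of `u ∈ μ_N(A)` is `μ_N(A)`-valued. [cite: MochizukiEtTh2009, Def 4.1 p.87] -/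
theorem conj_mul_inv_mem_mu {A : S.C} {N : ℕ+} (g : Aut A) {u : Aut A} (hu : u ∈ S.mu A N) :
    g * u * g⁻¹ * u⁻¹ ∈ S.mu A N :=
  S.mul_mem_mu (S.conj_mem_mu g hu) (S.inv_mem_mu hu)

variable {S}

/-! ### The bi-Kummer sections are sections over `H_{B_N}` (complements to `Sec4Thm44.lean`) -/

/-- `s'{}^{gp}(k) ∈ H_{B_N}`: the `s'`-section takes values in `H_{B_N} ⊆ Aut_C(B_N)` (the tree's `H_{B_N}`
is the inverse image of `H_{B_N}^bs`, Def 4.1 (ii); `Base(s'{}^{gp}(k)) = Base(k)` by `autBase_sNum`).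
[cite: MochizukiEtTh2009, Prop 4.3 (i) p.316 (PDF p.90)] -/
theorem BiKummerRoot.sNum_mem_HA {A B : S.C} {f : S.biratUnits A} {P : S.FractionPair f B}
    {N : ℕ+} {pullFrac : ∀ {A A' : S.C} (_ : A' ⟶ A), S.biratUnits A → S.biratUnits A'}
    {R : S.NthRoot f P N pullFrac} {hA : S.IsGalois R.AN} {hB : S.IsGalois R.BN}
    (Kr : S.BiKummerRoot R hA hB) (k : S.HA R.BN hB) : Kr.sNum k ∈ S.HA R.BN hB := by
  show S.autBase R.BN (Kr.sNum k) ∈ S.HAbs R.BN hB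
  rw [Kr.autBase_sNum k]
  exact k.2

/-- `s''{}^{gp}(k) ∈ H_{B_N}`. [cite: MochizukiEtTh2009, Prop 4.3 (i) p.316 (PDF p.90)] -/
theorem BiKummerRoot.sDen_mem_HA {A B : S.C} {f : S.biratUnits A} {P : S.FractionPair f B}
    {N : ℕ+} {pullFrac : ∀ {A A' : S.C} (_ : A' ⟶ A), S.biratUnits A → S.biratUnits A'}
    {R : S.NthRoot f P N pullFrac} {hA : S.IsGalois R.AN} {hB : S.IsGalois R.BN}
    (Kr : S.BiKummerRoot R hA hB) (k : S.HA R.BN hB) : Kr.sDen k ∈ S.HA R.BN hB := by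
  show S.autBase R.BN (Kr.sDen k) ∈ S.HAbs R.BN hB
  rw [Kr.autBase_sDen k]
  exact k.2

/-- `s'{}^{gp}(k) · k⁻¹ ∈ O^×(B_N)`: the section `s'{}^{gp}` lifts `k ∈ H_{B_N}` modulo `O^×(B_N)` (print's
`H_{B_N} ⊆ Aut_C(B_N)/O^×(B_N)`, p.316). [cite: MochizukiEtTh2009, Prop 4.3 (i) p.316 (PDF p.90)] -/
theorem BiKummerRoot.sNum_mul_inv_mem_units {A B : S.C} {f : S.biratUnits A} {P : S.FractionPair f B}
    {N : ℕ+} {pullFrac : ∀ {A A' : S.C} (_ : A' ⟶ A), S.biratUnits A → S.biratUnits A'}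
    {R : S.NthRoot f P N pullFrac} {hA : S.IsGalois R.AN} {hB : S.IsGalois R.BN}
    (Kr : S.BiKummerRoot R hA hB) (k : S.HA R.BN hB) :
    Kr.sNum k * (k : Aut R.BN)⁻¹ ∈ S.units R.BN := by
  refine ⟨?_, ?_⟩
  · have h1 : S.autBase R.BN (Kr.sNum k * (k : Aut R.BN)⁻¹) = 1 := by
      rw [map_mul, map_inv, Kr.autBase_sNum k, mul_inv_cancel]
    exact congrArg Iso.hom h1
  · exact (ModelFrobenioid.degFr_hom_eq_one _).1

/-- `s''{}^{gp}(k) · k⁻¹ ∈ O^×(B_N)`. [cite: MochizukiEtTh2009, Prop 4.3 (i) p.316 (PDF p.90)] -/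
theorem BiKummerRoot.sDen_mul_inv_mem_units {A B : S.C} {f : S.biratUnits A} {P : S.FractionPair f B}
    {N : ℕ+} {pullFrac : ∀ {A A' : S.C} (_ : A' ⟶ A), S.biratUnits A → S.biratUnits A'}
    {R : S.NthRoot f P N pullFrac} {hA : S.IsGalois R.AN} {hB : S.IsGalois R.BN}
    (Kr : S.BiKummerRoot R hA hB) (k : S.HA R.BN hB) :
    Kr.sDen k * (k : Aut R.BN)⁻¹ ∈ S.units R.BN := by
  refine ⟨?_, ?_⟩
  · have h1 : S.autBase R.BN (Kr.sDen k * (k : Aut R.BN)⁻¹) = 1 := by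
      rw [map_mul, map_inv, Kr.autBase_sDen k, mul_inv_cancel]
    exact congrArg Iso.hom h1
  · exact (ModelFrobenioid.degFr_hom_eq_one _).1

/-! ### (C1b) The difference `c(h) = s'{}^{gp}(h) · s''{}^{gp}(h)⁻¹` is a twisted homomorphism -/

/-- **Prop 4.3 (iii), "determines a twisted homomorphism"** — the crossed-homomorphism identity for the
conjugation action THROUGH THE SECTION `s'{}^{gp}`: `c(hk) = (s'{}^{gp}(h) · c(k) · s'{}^{gp}(h)⁻¹) · c(h)`
(a formal consequence of `s'{}^{gp}`, `s''{}^{gp}` being group homomorphisms; valid in any group).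
[cite: MochizukiEtTh2009, Prop 4.3 (iii) p.317 (PDF p.91)] -/
theorem BiKummerRoot.diff_mul' {A B : S.C} {f : S.biratUnits A} {P : S.FractionPair f B}
    {N : ℕ+} {pullFrac : ∀ {A A' : S.C} (_ : A' ⟶ A), S.biratUnits A → S.biratUnits A'}
    {R : S.NthRoot f P N pullFrac} {hA : S.IsGalois R.AN} {hB : S.IsGalois R.BN}
    (Kr : S.BiKummerRoot R hA hB) (h k : S.HA R.BN hB) :
    Kr.sNum (h * k) * (Kr.sDen (h * k))⁻¹ =
      (Kr.sNum h * (Kr.sNum k * (Kr.sDen k)⁻¹) * (Kr.sNum h)⁻¹) * (Kr.sNum h * (Kr.sDen h)⁻¹) := by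
  rw [map_mul, map_mul]
  group

/-- **Prop 4.3 (iii), "determines a twisted homomorphism `H_{B_N} → μ_N(B_N)`"** — the cocycle identity in
print's order, `c(hk) = c(h) · (s'{}^{gp}(h) · c(k) · s'{}^{gp}(h)⁻¹)`: the two factors commute because both
lie in the commutative group `O^×(B_N)` (`sNum_mul_sDen_inv_mem_units`, `conj_mem_units`, `units_comm`).
This is literally the defining identity `f(gh) = f(g) · (φ(g) f(h) φ(g)⁻¹)` of the tree's crossed
homomorphisms `contCocycles φ A H` (`EtaleTheta/ContH1.lean`) for `φ = s'{}^{gp}`, `A = O^×(B_N)`.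
[cite: MochizukiEtTh2009, Prop 4.3 (iii) p.317 (PDF p.91)] -/
theorem BiKummerRoot.diff_mul {A B : S.C} {f : S.biratUnits A} {P : S.FractionPair f B}
    {N : ℕ+} {pullFrac : ∀ {A A' : S.C} (_ : A' ⟶ A), S.biratUnits A → S.biratUnits A'}
    {R : S.NthRoot f P N pullFrac} {hA : S.IsGalois R.AN} {hB : S.IsGalois R.BN}
    (Kr : S.BiKummerRoot R hA hB) (h k : S.HA R.BN hB) :
    Kr.sNum (h * k) * (Kr.sDen (h * k))⁻¹ =
      (Kr.sNum h * (Kr.sDen h)⁻¹) * (Kr.sNum h * (Kr.sNum k * (Kr.sDen k)⁻¹) * (Kr.sNum h)⁻¹) := by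
  rw [Kr.diff_mul' h k]
  exact S.units_comm (S.conj_mem_units _ (Kr.sNum_mul_sDen_inv_mem_units k))
    (Kr.sNum_mul_sDen_inv_mem_units h)

/-- **Prop 4.3 (iii), the twisted homomorphism for the NATURAL action of `H_{B_N}`**: `c(hk) = c(h) ·
(h · c(k) · h⁻¹)`, `H_{B_N} ⊆ Aut_C(B_N)` acting on `O^×(B_N) ⊇ μ_N(B_N)` by conjugation (well defined on
print's `H_{B_N} ⊆ Aut_C(B_N)/O^×(B_N)` by `conj_eq_conj_of_mul_inv_mem_units`); conjugation through `h` and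
through `s'{}^{gp}(h)` agree since `s'{}^{gp}(h) · h⁻¹ ∈ O^×(B_N)`.
[cite: MochizukiEtTh2009, Prop 4.3 (iii) p.317 (PDF p.91)] -/
theorem BiKummerRoot.diff_mul_conj {A B : S.C} {f : S.biratUnits A} {P : S.FractionPair f B}
    {N : ℕ+} {pullFrac : ∀ {A A' : S.C} (_ : A' ⟶ A), S.biratUnits A → S.biratUnits A'}
    {R : S.NthRoot f P N pullFrac} {hA : S.IsGalois R.AN} {hB : S.IsGalois R.BN}
    (Kr : S.BiKummerRoot R hA hB) (h k : S.HA R.BN hB) :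
    Kr.sNum (h * k) * (Kr.sDen (h * k))⁻¹ =
      (Kr.sNum h * (Kr.sDen h)⁻¹) *
        ((h : Aut R.BN) * (Kr.sNum k * (Kr.sDen k)⁻¹) * (h : Aut R.BN)⁻¹) := by
  rw [Kr.diff_mul h k, S.conj_eq_conj_of_mul_inv_mem_units (Kr.sNum_mul_inv_mem_units h)
    (Kr.sNum_mul_sDen_inv_mem_units k)]

/-- The twisted homomorphism is trivial at `1` (as every crossed homomorphism).
[cite: MochizukiEtTh2009, Prop 4.3 (iii) p.317 (PDF p.91)] -/
theorem BiKummerRoot.diff_one {A B : S.C} {f : S.biratUnits A} {P : S.FractionPair f B}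
    {N : ℕ+} {pullFrac : ∀ {A A' : S.C} (_ : A' ⟶ A), S.biratUnits A → S.biratUnits A'}
    {R : S.NthRoot f P N pullFrac} {hA : S.IsGalois R.AN} {hB : S.IsGalois R.BN}
    (Kr : S.BiKummerRoot R hA hB) : Kr.sNum 1 * (Kr.sDen 1)⁻¹ = 1 := by
  rw [map_one, map_one, inv_one, mul_one]

/-! ### (C4) Invariance under the conjugation operations (a), (b) of Prop 4.3 (ii) -/

/-- **(C4)(a): simultaneous conjugation by `ζ ∈ O^×(B_N)` does not change the difference cocycle** — not
even by a coboundary: `(ζ s' ζ⁻¹)(ζ s'' ζ⁻¹)⁻¹ = ζ c ζ⁻¹ = c`, as `O^×(B_N)` is commutative.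
[cite: MochizukiEtTh2009, Prop 4.3 (iii) p.317 (PDF p.91)] -/
theorem BiKummerRoot.diff_eq_of_conj {A B : S.C} {f : S.biratUnits A} {P : S.FractionPair f B}
    {N : ℕ+} {pullFrac : ∀ {A A' : S.C} (_ : A' ⟶ A), S.biratUnits A → S.biratUnits A'}
    {R : S.NthRoot f P N pullFrac} {hA : S.IsGalois R.AN} {hB : S.IsGalois R.BN}
    (Kr Kr' : S.BiKummerRoot R hA hB) {ζ : Aut R.BN} (hζ : ζ ∈ S.units R.BN) (k : S.HA R.BN hB)
    (hnum : Kr'.sNum k = ζ * Kr.sNum k * ζ⁻¹) (hden : Kr'.sDen k = ζ * Kr.sDen k * ζ⁻¹) :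
    Kr'.sNum k * (Kr'.sDen k)⁻¹ = Kr.sNum k * (Kr.sDen k)⁻¹ := by
  have hc : ζ * (Kr.sNum k * (Kr.sDen k)⁻¹) = Kr.sNum k * (Kr.sDen k)⁻¹ * ζ :=
    S.units_comm hζ (Kr.sNum_mul_sDen_inv_mem_units k)
  rw [hnum, hden]
  calc ζ * Kr.sNum k * ζ⁻¹ * (ζ * Kr.sDen k * ζ⁻¹)⁻¹ = ζ * (Kr.sNum k * (Kr.sDen k)⁻¹) * ζ⁻¹ := by group
    _ = Kr.sNum k * (Kr.sDen k)⁻¹ * ζ * ζ⁻¹ := by rw [hc]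
    _ = Kr.sNum k * (Kr.sDen k)⁻¹ := by group

/-- **(C4)(a)+(b): after simultaneous conjugation by `ζ ∈ O^×(B_N)` and non-simultaneous conjugation of
`s''{}^{gp}` by `u ∈ μ_N(B_N)` (the operations of Prop 4.3 (ii), in the shape of the conclusion of the typed
`Prop43_ii`) the difference cocycle changes by the COBOUNDARY of `u`**:
`c'(k) = c(k) · ((s'{}^{gp}(k) · u · s'{}^{gp}(k)⁻¹) · u⁻¹)` — i.e. `c' = c · ∂u` with `∂u(k) = (ᵏu) u⁻¹`, the
tree's `contCoboundaries` relation; hence `c`, `c'` have the same class in `H¹(H_{B_N}, μ_N(B_N))`.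
[cite: MochizukiEtTh2009, Prop 4.3 (iii) p.317 (PDF p.91)] -/
theorem BiKummerRoot.diff_eq_mul_coboundary_of_conj {A B : S.C} {f : S.biratUnits A}
    {P : S.FractionPair f B} {N : ℕ+}
    {pullFrac : ∀ {A A' : S.C} (_ : A' ⟶ A), S.biratUnits A → S.biratUnits A'}
    {R : S.NthRoot f P N pullFrac} {hA : S.IsGalois R.AN} {hB : S.IsGalois R.BN}
    (Kr Kr' : S.BiKummerRoot R hA hB) {ζ u : Aut R.BN} (hζ : ζ ∈ S.units R.BN) (hu : u ∈ S.mu R.BN N)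
    (k : S.HA R.BN hB) (hnum : Kr'.sNum k = ζ * Kr.sNum k * ζ⁻¹)
    (hden : Kr'.sDen k = (u * ζ) * Kr.sDen k * (u * ζ)⁻¹) :
    Kr'.sNum k * (Kr'.sDen k)⁻¹ =
      (Kr.sNum k * (Kr.sDen k)⁻¹) * ((Kr.sNum k * u * (Kr.sNum k)⁻¹) * u⁻¹) := by
  -- abbreviations (as hypotheses, to keep the `calc` readable)
  have h1 : ζ⁻¹ * u = u * ζ⁻¹ := S.units_comm ((S.units R.BN).inv_mem hζ) hu.1
  have hsu : Kr.sNum k * u * (Kr.sNum k)⁻¹ ∈ S.units R.BN := S.conj_mem_units _ hu.1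
  have hc : Kr.sNum k * (Kr.sDen k)⁻¹ ∈ S.units R.BN := Kr.sNum_mul_sDen_inv_mem_units k
  have h2 : ζ * (Kr.sNum k * u * (Kr.sNum k)⁻¹ * (Kr.sNum k * (Kr.sDen k)⁻¹)) =
      Kr.sNum k * u * (Kr.sNum k)⁻¹ * (Kr.sNum k * (Kr.sDen k)⁻¹) * ζ :=
    S.units_comm hζ ((S.units R.BN).mul_mem hsu hc)
  have h3 : Kr.sNum k * u * (Kr.sNum k)⁻¹ * (Kr.sNum k * (Kr.sDen k)⁻¹) =
      Kr.sNum k * (Kr.sDen k)⁻¹ * (Kr.sNum k * u * (Kr.sNum k)⁻¹) := S.units_comm hsu hc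
  rw [hnum, hden]
  calc ζ * Kr.sNum k * ζ⁻¹ * (u * ζ * Kr.sDen k * (u * ζ)⁻¹)⁻¹
        = ζ * Kr.sNum k * (ζ⁻¹ * u) * ζ * (Kr.sDen k)⁻¹ * ζ⁻¹ * u⁻¹ := by group
    _ = ζ * Kr.sNum k * (u * ζ⁻¹) * ζ * (Kr.sDen k)⁻¹ * ζ⁻¹ * u⁻¹ := by rw [h1]
    _ = ζ * (Kr.sNum k * u * (Kr.sNum k)⁻¹ * (Kr.sNum k * (Kr.sDen k)⁻¹)) * ζ⁻¹ * u⁻¹ := by group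
    _ = Kr.sNum k * u * (Kr.sNum k)⁻¹ * (Kr.sNum k * (Kr.sDen k)⁻¹) * ζ * ζ⁻¹ * u⁻¹ := by rw [h2]
    _ = Kr.sNum k * u * (Kr.sNum k)⁻¹ * (Kr.sNum k * (Kr.sDen k)⁻¹) * u⁻¹ := by group
    _ = Kr.sNum k * (Kr.sDen k)⁻¹ * (Kr.sNum k * u * (Kr.sNum k)⁻¹) * u⁻¹ := by rw [h3]
    _ = (Kr.sNum k * (Kr.sDen k)⁻¹) * ((Kr.sNum k * u * (Kr.sNum k)⁻¹) * u⁻¹) := by group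

/-- The same with the coboundary written for the natural action of `H_{B_N}`:
`c'(k) = c(k) · ((k u k⁻¹) · u⁻¹)`. [cite: MochizukiEtTh2009, Prop 4.3 (iii) p.317 (PDF p.91)] -/
theorem BiKummerRoot.diff_eq_mul_coboundary_of_conj' {A B : S.C} {f : S.biratUnits A}
    {P : S.FractionPair f B} {N : ℕ+}
    {pullFrac : ∀ {A A' : S.C} (_ : A' ⟶ A), S.biratUnits A → S.biratUnits A'}
    {R : S.NthRoot f P N pullFrac} {hA : S.IsGalois R.AN} {hB : S.IsGalois R.BN}
    (Kr Kr' : S.BiKummerRoot R hA hB) {ζ u : Aut R.BN} (hζ : ζ ∈ S.units R.BN) (hu : u ∈ S.mu R.BN N)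
    (k : S.HA R.BN hB) (hnum : Kr'.sNum k = ζ * Kr.sNum k * ζ⁻¹)
    (hden : Kr'.sDen k = (u * ζ) * Kr.sDen k * (u * ζ)⁻¹) :
    Kr'.sNum k * (Kr'.sDen k)⁻¹ =
      (Kr.sNum k * (Kr.sDen k)⁻¹) * (((k : Aut R.BN) * u * (k : Aut R.BN)⁻¹) * u⁻¹) := by
  rw [Kr.diff_eq_mul_coboundary_of_conj Kr' hζ hu k hnum hden,
    S.conj_eq_conj_of_mul_inv_mem_units (Kr.sNum_mul_inv_mem_units k) hu.1]

/-- **Prop 4.3 (iii), last sentence — UNCONDITIONAL: "this cohomology class is independent of the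
[simultaneous and non-simultaneous] conjugation operations discussed in (ii)"**: for any two bi-Kummer
`N`-th roots `K, K'` of the same root datum with the same identification `H_{A_N} ≅ H_{B_N}` and
`O^×(A_N)`-conjugate trivializing sections (the data compared by the typed `Prop43_ii`; domain `≅ A_⊙`),
there is `u ∈ μ_N(B_N)` with `c_{K'} = c_K · ∂u`, `∂u(k) = (s'{}^{gp}(k) u s'{}^{gp}(k)⁻¹) u⁻¹` — by
Prop 4.3 (ii), a THEOREM for every setting (`prop43_ii_holds`), and `diff_eq_mul_coboundary_of_conj`.
[cite: MochizukiEtTh2009, Prop 4.3 (iii) p.317 (PDF p.91)] -/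
theorem BiKummerRoot.exists_mu_diff_eq_mul_coboundary {A B : S.C} {f : S.biratUnits A}
    {P : S.FractionPair f B} {N : ℕ+}
    {pullFrac : ∀ {A A' : S.C} (_ : A' ⟶ A), S.biratUnits A → S.biratUnits A'}
    {R : S.NthRoot f P N pullFrac} {hA : S.IsGalois R.AN} {hB : S.IsGalois R.BN}
    (Kr Kr' : S.BiKummerRoot R hA hB) (hident : Kr'.ident = Kr.ident)
    (hstriv : ∃ ζA : S.units R.AN, ∀ h, Kr'.striv h = (ζA : Aut R.AN) * Kr.striv h * (ζA : Aut R.AN)⁻¹)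
    (hAo : Nonempty (A ≅ S.Aodot)) :
    ∃ u : Aut R.BN, u ∈ S.mu R.BN N ∧ ∀ k : S.HA R.BN hB,
      Kr'.sNum k * (Kr'.sDen k)⁻¹ =
        (Kr.sNum k * (Kr.sDen k)⁻¹) * ((Kr.sNum k * u * (Kr.sNum k)⁻¹) * u⁻¹) := by
  have h43 : S.Prop43_ii pullFrac := prop43_ii_holds S pullFrac
  obtain ⟨ζ, u, hζu⟩ := h43 R hA hB Kr Kr' hident hstriv hAo
  exact ⟨(u : Aut R.BN), u.2, fun k =>
    Kr.diff_eq_mul_coboundary_of_conj Kr' ζ.2 u.2 k (hζu k).1 (hζu k).2⟩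

/-- The same for the natural action of `H_{B_N}`: `c_{K'}(k) = c_K(k) · ((k u k⁻¹) u⁻¹)` for some
`u ∈ μ_N(B_N)`, the coboundary being `μ_N(B_N)`-valued (`conj_mul_inv_mem_mu`).
[cite: MochizukiEtTh2009, Prop 4.3 (iii) p.317 (PDF p.91)] -/
theorem BiKummerRoot.exists_mu_diff_eq_mul_coboundary' {A B : S.C} {f : S.biratUnits A}
    {P : S.FractionPair f B} {N : ℕ+}
    {pullFrac : ∀ {A A' : S.C} (_ : A' ⟶ A), S.biratUnits A → S.biratUnits A'}
    {R : S.NthRoot f P N pullFrac} {hA : S.IsGalois R.AN} {hB : S.IsGalois R.BN}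
    (Kr Kr' : S.BiKummerRoot R hA hB) (hident : Kr'.ident = Kr.ident)
    (hstriv : ∃ ζA : S.units R.AN, ∀ h, Kr'.striv h = (ζA : Aut R.AN) * Kr.striv h * (ζA : Aut R.AN)⁻¹)
    (hAo : Nonempty (A ≅ S.Aodot)) :
    ∃ u : Aut R.BN, u ∈ S.mu R.BN N ∧ ∀ k : S.HA R.BN hB,
      ((k : Aut R.BN) * u * (k : Aut R.BN)⁻¹ * u⁻¹ ∈ S.mu R.BN N) ∧
      Kr'.sNum k * (Kr'.sDen k)⁻¹ =
        (Kr.sNum k * (Kr.sDen k)⁻¹) * (((k : Aut R.BN) * u * (k : Aut R.BN)⁻¹) * u⁻¹) := by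
  have h43 : S.Prop43_ii pullFrac := prop43_ii_holds S pullFrac
  obtain ⟨ζ, u, hζu⟩ := h43 R hA hB Kr Kr' hident hstriv hAo
  exact ⟨(u : Aut R.BN), u.2, fun k => ⟨S.conj_mul_inv_mem_mu (k : Aut R.BN) u.2,
    Kr.diff_eq_mul_coboundary_of_conj' Kr' ζ.2 u.2 k (hζu k).1 (hζu k).2⟩⟩

end BiKummerSetting

end Literature.AnabelianGeometry.EtaleTheta

end
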